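import Summits.Ventures.HSemireg.WedgePointPairPowersPerQRank

/-!
# Venture HSemireg — per-`q` blocks of the `n`-fold box of `m`-dimensional point pairs, companion: THE DEGREE-1 ROW IN CLOSED
# FORM for every `m ≥ 1`, `n`: `rank_q(⋀¹) = mn` on the residues `q ≡ 0, −1 (mod m)` below `mn`, `0` elsewhere

HONEST FRAMING. Part of the Lean index of the computation cell `pub-hsemireg` (seat p10 gen 4, Sunday typer «UNIFORM-IN-n»).
Finite combinatorics of th-7's canonical sources + the rank theorem of `WedgePointPairPowersPerQRank.lean` ONLY: no variety, no
cohomology theory, no sheaf, no Ext group, no semiregularity map is constructed here; nothing here says that HC / HC_CM / HC_AV holds;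
no Literature fact is declared or used.  Custodian versions: STRUCTURE.md v1.0-SIGNED 9b196a05977dd067 (§1.1 C10′ «σ¹ = 4n», C13),
theory/FORMULA-N.md PART A §4.1″ (th-6) / PART B §K (th-7).  Dictionary quoted, not asserted.

THIS FILE: §1 degree-`1` option data is ONE single-letter block, all other blocks empty (`oneBlock`, `exists_eq_oneBlock_of_kf_eq_one`);
§2 the degree-`1` classes reaching block `q` are the pairs (block `i`, one-letter source `o`) with `q = q_f(o) + jm` for some
`j < n` (`Fset_one_eq_image`), so `|Fset m n 1 q| = n · |T1 m n q|` (`card_Fset_one`); §3 the one-letter sources are the `X`-letters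
(`q`-part `m − 1`) and, for `m ≥ 2`, the `Y`-letters (`q`-part `0`): `|T1 m n q| = m·[∃ j < n, q = m − 1 + jm] + m·[2 ≤ m ∧ ∃ j < n, q = jm]`
(`card_T1`); §4 the reach conditions as residues (`q ≡ m − 1` resp. `q ≡ 0 (mod m)`, and `q < mn`); §5 **THE DEGREE-1 ROW, UNIFORM IN
`n` AND `m`**: for every field, `m ≥ 1`, `n`, `q`, `a, c ≠ 0`,
`rank(q-block of θ ↦ θ ∧ F ∣ ⋀¹ K^{(m+m)n}) = mn` if `q < mn` and `q mod m ∈ {0, m − 1}`, and `0` otherwise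
(`finrank_range_blockProj_wedge_pairBox_one_closed`) — for `m = 2` every `q < 2n` qualifies (the surface row `(2n, …, 2n)` of
`WedgeSurfacePowersPerQOverlap.finrank_range_blockProj_wedge_surfaceBox_one_closed`, in this file's layout), for `m = 3`, `n = 3` it is
the pre-registered `(9,0,9,9,0,9,9,0,9,0)`; as arithmetic `genCount m n 1 q` has the same closed form (`genCount_one_closed`).
Namespace `Summit.Ventures.HSemireg.Wedge.PairPowers`, new names only; independent of the sibling leaves (Overlap / Symm / Extreme).
-/

open Module Set Set.powersetCard Polynomial

namespace Summit.Ventures.HSemireg.Wedge.PairPowers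

open Summit.Ventures.HSemireg.Wedge Summit.Ventures.HSemireg.Wedge.Kunneth

variable (K : Type*) [Field K] {m : ℕ} {n : ℕ}

/-! ## §1. Degree-1 option data: one single-letter block -/

/-- option data with the canonical source `o` on block `i` and the empty source on every other block. -/
def oneBlock (i : Fin n) (o : Opt m) : Fin n → Opt m := Function.update (fun _ => oEmpty m) i o

/-- block `i` of `oneBlock i o` is `o`. -/
lemma oneBlock_apply_same (i : Fin n) (o : Opt m) : oneBlock i o i = o := by simp [oneBlock]

/-- the other blocks of `oneBlock i o` are empty. -/
lemma oneBlock_apply_ne {i i' : Fin n} (h : i' ≠ i) (o : Opt m) : oneBlock i o i' = oEmpty m := by simp [oneBlock, h]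

/-- its degree is `|o|`. -/
lemma kf_oneBlock (i : Fin n) (o : Opt m) : kf (oneBlock i o) = (o.1).card := by
  rw [kf, Finset.sum_eq_single i]
  · rw [oneBlock_apply_same]
  · intro j _ hj
    rw [oneBlock_apply_ne hj]
    exact Finset.card_empty
  · intro h
    exact absurd (Finset.mem_univ i) h

/-- its fixed `q`-part is `q_f(o)`. -/
lemma qff_oneBlock (i : Fin n) (o : Opt m) : qff (oneBlock i o) = lqf m o := by
  rw [qff, Finset.sum_eq_single i]
  · rw [oneBlock_apply_same]
  · intro j _ hj
    rw [oneBlock_apply_ne hj]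
    exact Ys_mem_ltg_empty.2.2.2
  · intro h
    exact absurd (Finset.mem_univ i) h

/-- with `o` non-empty it has `n − 1` empty blocks. -/
lemma zf_oneBlock (i : Fin n) {o : Opt m} (ho : o.1 ≠ ∅) : zf (oneBlock i o) = n - 1 := by
  rw [zf_eq_card]
  have h : (Finset.univ.filter fun j => ((oneBlock i o j).1) = ∅) = Finset.univ.erase i := by
    ext j
    rw [Finset.mem_filter, Finset.mem_erase]
    by_cases hj : j = i
    · subst hj
      rw [oneBlock_apply_same]
      exact ⟨fun h => absurd h.2 ho, fun h => absurd rfl h.1⟩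
    · rw [oneBlock_apply_ne hj]
      exact ⟨fun _ => ⟨hj, Finset.mem_univ j⟩, fun _ => ⟨Finset.mem_univ j, rfl⟩⟩
  rw [h, Finset.card_erase_of_mem (Finset.mem_univ i), Finset.card_univ, Fintype.card_fin]

/-- **degree-`1` option data IS one single-letter block** (the other blocks empty). -/
theorem exists_eq_oneBlock_of_kf_eq_one {f : Fin n → Opt m} (hf : kf f = 1) :
    ∃ i, ((f i).1).card = 1 ∧ f = oneBlock i (f i) := by
  have hsum : (∑ i, ((f i).1).card) ≠ 0 := by change kf f ≠ 0; omega
  obtain ⟨i, -, hi⟩ := Finset.exists_ne_zero_of_sum_ne_zero hsum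
  have hsplit : kf f = ((f i).1).card + ∑ j ∈ Finset.univ.erase i, ((f j).1).card := by
    rw [kf, ← Finset.add_sum_erase _ _ (Finset.mem_univ i)]
  have hrest : ∑ j ∈ Finset.univ.erase i, ((f j).1).card = 0 := by omega
  refine ⟨i, by omega, funext fun j => ?_⟩
  by_cases hj : j = i
  · subst hj
    rw [oneBlock_apply_same]
  · rw [oneBlock_apply_ne hj]
    have h0 : ((f j).1).card = 0 := Finset.sum_eq_zero_iff.mp hrest j (Finset.mem_erase.mpr ⟨hj, Finset.mem_univ j⟩)
    exact (lz_eq (f j)).2.mp (Finset.card_eq_zero.mp h0)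

/-- `oneBlock` is injective on (block, non-empty source). -/
lemma oneBlock_inj {i i' : Fin n} {o o' : Opt m} (ho : o.1 ≠ ∅) (h : oneBlock i o = oneBlock i' o') : i = i' ∧ o = o' := by
  have hi : i = i' := by
    by_contra hi
    have h1 := congr_fun h i
    rw [oneBlock_apply_same, oneBlock_apply_ne hi] at h1
    exact ho (by rw [h1]; rfl)
  subst hi
  have h1 := congr_fun h i
  rw [oneBlock_apply_same, oneBlock_apply_same] at h1
  exact ⟨rfl, h1⟩

/-! ## §2. The degree-1 classes reaching block `q` -/

variable (m n) in
/-- the one-letter canonical sources `o` such that the class of `o` on some block (the other `n − 1` blocks empty) reaches block `q`: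
`q = q_f(o) + jm` for some `j < n`. -/
def T1 (q : ℕ) : Finset (Opt m) := Finset.univ.filter fun o => (o.1).card = 1 ∧ ∃ j : Fin n, q = lqf m o + m * (j : ℕ)

/-- membership in `T1`. -/
lemma mem_T1 {q : ℕ} {o : Opt m} : o ∈ T1 m n q ↔ (o.1).card = 1 ∧ ∃ j, j < n ∧ q = lqf m o + m * j := by
  rw [T1, Finset.mem_filter, and_iff_right (Finset.mem_univ o)]
  exact and_congr Iff.rfl ⟨fun ⟨j, h⟩ => ⟨j, j.2, h⟩, fun ⟨j, hj, h⟩ => ⟨⟨j, hj⟩, h⟩⟩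

/-- **the degree-`1` classes reaching block `q` are the `oneBlock i o`, `i` any block, `o ∈ T1 m n q`.** -/
theorem Fset_one_eq_image (q : ℕ) :
    Fset m n 1 q = ((Finset.univ : Finset (Fin n)) ×ˢ T1 m n q).image fun p => oneBlock p.1 p.2 := by
  ext f
  rw [mem_Fset, Finset.mem_image]
  constructor
  · rintro ⟨hk, j, hj, hq⟩
    obtain ⟨i, hi, hf⟩ := exists_eq_oneBlock_of_kf_eq_one hk
    have ho : (f i).1 ≠ ∅ := fun h => by rw [h, Finset.card_empty] at hi; omega
    have hz : zf f = n - 1 := by rw [hf, zf_oneBlock i ho]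
    have hqf : qff f = lqf m (f i) := by rw [hf, qff_oneBlock, oneBlock_apply_same]
    refine ⟨(i, f i), Finset.mem_product.mpr ⟨Finset.mem_univ i, mem_T1.mpr ⟨hi, j, ?_, by rw [← hqf, hq]⟩⟩, hf.symm⟩
    have := i.2
    omega
  · rintro ⟨⟨i, o⟩, hp, rfl⟩
    obtain ⟨ho1, j, hj, hq⟩ := mem_T1.mp (Finset.mem_product.mp hp).2
    have ho : o.1 ≠ ∅ := fun h => by rw [h, Finset.card_empty] at ho1; omega
    refine ⟨by rw [kf_oneBlock, ho1], j, by rw [zf_oneBlock i ho]; omega, by rw [qff_oneBlock, hq]⟩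

/-- so **`|Fset m n 1 q| = n · |T1 m n q|`**. -/
theorem card_Fset_one (q : ℕ) : (Fset m n 1 q).card = n * (T1 m n q).card := by
  rw [Fset_one_eq_image, Finset.card_image_of_injOn, Finset.card_product, Finset.card_univ, Fintype.card_fin]
  rintro ⟨i, o⟩ hp ⟨i', o'⟩ - h
  have ho1 := (mem_T1.mp (Finset.mem_product.mp (Finset.mem_coe.mp hp)).2).1
  have ho : o.1 ≠ ∅ := fun e => by rw [e, Finset.card_empty] at ho1; omega
  obtain ⟨rfl, rfl⟩ := oneBlock_inj ho h
  rfl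

/-! ## §3. The one-letter sources: `X`-letters (`q`-part `m − 1`) and, for `m ≥ 2`, `Y`-letters (`q`-part `0`) -/

/-- a singleton is a canonical source iff its letter is an `X`-letter, or a `Y`-letter with `m ≥ 2`. -/
lemma singleton_mem_optSet_iff (a : Fin (m + m)) : ({a} : Finset (Fin (m + m))) ∈ optSet m ↔ a ∈ Xs m ∨ (a ∈ Ys m ∧ 2 ≤ m) := by
  rw [mem_optSet, Finset.singleton_subset_iff, Finset.singleton_subset_iff, Finset.card_singleton]
  constructor
  · rintro (h | ⟨h, -, h2⟩)
    · exact Or.inl h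
    · exact Or.inr ⟨h, h2⟩
  · rintro (h | ⟨h, h2⟩)
    · exact Or.inl h
    · exact Or.inr ⟨h, Nat.one_pos, h2⟩

/-- the one-letter source on the letter `a` (the empty source if `{a}` is not canonical, i.e. `a ∈ Y` and `m = 1`). -/
def osing (a : Fin (m + m)) : Opt m := if h : ({a} : Finset (Fin (m + m))) ∈ optSet m then ⟨{a}, h⟩ else oEmpty m

/-- its letter set. -/
lemma osing_val {a : Fin (m + m)} (h : ({a} : Finset (Fin (m + m))) ∈ optSet m) : (osing a).1 = {a} := by
  rw [osing, dif_pos h]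

/-- the `q`-part of a one-letter source: `m − 1` on an `X`-letter, `0` on a `Y`-letter. -/
lemma lqf_osing {a : Fin (m + m)} (h : ({a} : Finset (Fin (m + m))) ∈ optSet m) :
    lqf m (osing a) = if a ∈ Xs m then m - 1 else 0 := by
  have e : lqf m (osing a) = if (osing a).1 ⊆ Xs m ∧ (osing a).1 ≠ ∅ then m - ((osing a).1).card else 0 := rfl
  rw [e, osing_val h]
  by_cases ha : a ∈ Xs m
  · rw [if_pos ⟨Finset.singleton_subset_iff.mpr ha, Finset.singleton_ne_empty a⟩, if_pos ha, Finset.card_singleton]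
  · rw [if_neg (fun h' => ha (Finset.singleton_subset_iff.mp h'.1)), if_neg ha]

/-- every one-letter canonical source is an `osing a` with `{a}` canonical. -/
lemma eq_osing_of_card_eq_one {o : Opt m} (ho : (o.1).card = 1) :
    ∃ a, ({a} : Finset (Fin (m + m))) ∈ optSet m ∧ o = osing a := by
  obtain ⟨a, ha⟩ := Finset.card_eq_one.mp ho
  have h : ({a} : Finset (Fin (m + m))) ∈ optSet m := ha ▸ o.2
  exact ⟨a, h, Subtype.ext (by rw [osing_val h, ha])⟩

variable (m n) in
/-- the letters `a` whose one-letter source reaches block `q`. -/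
def L1 (q : ℕ) : Finset (Fin (m + m)) :=
  Finset.univ.filter fun a => ({a} : Finset (Fin (m + m))) ∈ optSet m ∧ ∃ j : Fin n, q = lqf m (osing a) + m * (j : ℕ)

/-- `T1` is the image of `L1` under `osing`, injectively. -/
lemma T1_eq_image (q : ℕ) : T1 m n q = (L1 m n q).image osing := by
  ext o
  rw [mem_T1, Finset.mem_image]
  constructor
  · rintro ⟨ho, j, hj, hq⟩
    obtain ⟨a, ha, rfl⟩ := eq_osing_of_card_eq_one ho
    exact ⟨a, Finset.mem_filter.mpr ⟨Finset.mem_univ a, ha, ⟨j, hj⟩, hq⟩, rfl⟩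
  · rintro ⟨a, ha, rfl⟩
    obtain ⟨-, h, j, hq⟩ := Finset.mem_filter.mp ha
    exact ⟨by rw [osing_val h, Finset.card_singleton], j, j.2, hq⟩

/-- so `|T1| = |L1|`. -/
lemma card_T1_eq_card_L1 (q : ℕ) : (T1 m n q).card = (L1 m n q).card := by
  rw [T1_eq_image, Finset.card_image_of_injOn]
  intro a ha a' ha' h
  have h1 := (Finset.mem_filter.mp (Finset.mem_coe.mp ha)).2.1
  have h2 := (Finset.mem_filter.mp (Finset.mem_coe.mp ha')).2.1
  have e : ({a} : Finset (Fin (m + m))) = {a'} := by rw [← osing_val h1, ← osing_val h2, h]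
  exact Finset.singleton_injective e

/-- **`|T1 m n q| = m·[∃ j < n, q = m − 1 + jm] + m·[2 ≤ m ∧ ∃ j < n, q = jm]`** (the `X`-letters, and for `m ≥ 2` the `Y`-letters). -/
theorem card_T1 (q : ℕ) :
    (T1 m n q).card = (if ∃ j, j < n ∧ q = m - 1 + m * j then m else 0) +
      (if 2 ≤ m ∧ ∃ j, j < n ∧ q = m * j then m else 0) := by
  classical
  rw [card_T1_eq_card_L1]
  have hsplit : L1 m n q = (Xs m).filter (fun _ => ∃ j, j < n ∧ q = m - 1 + m * j) ∪
      (Ys m).filter (fun _ => 2 ≤ m ∧ ∃ j, j < n ∧ q = m * j) := by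
    ext a
    rw [L1, Finset.mem_filter, Finset.mem_union, Finset.mem_filter, Finset.mem_filter, and_iff_right (Finset.mem_univ a)]
    constructor
    · rintro ⟨h, j, hq⟩
      rw [lqf_osing h] at hq
      rcases (singleton_mem_optSet_iff a).mp h with hX | ⟨hY, h2⟩
      · rw [if_pos hX] at hq
        exact Or.inl ⟨hX, j, j.2, hq⟩
      · have hX : a ∉ Xs m := fun hX => Finset.disjoint_left.mp (WedgePair.disjoint_XY m) hX hY
        rw [if_neg hX, zero_add] at hq
        exact Or.inr ⟨hY, h2, j, j.2, hq⟩
    · rintro (⟨hX, j, hj, hq⟩ | ⟨hY, h2, j, hj, hq⟩)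
      · have h : ({a} : Finset (Fin (m + m))) ∈ optSet m := (singleton_mem_optSet_iff a).mpr (Or.inl hX)
        exact ⟨h, ⟨j, hj⟩, by rw [lqf_osing h, if_pos hX]; exact hq⟩
      · have h : ({a} : Finset (Fin (m + m))) ∈ optSet m := (singleton_mem_optSet_iff a).mpr (Or.inr ⟨hY, h2⟩)
        have hX : a ∉ Xs m := fun hX => Finset.disjoint_left.mp (WedgePair.disjoint_XY m) hX hY
        exact ⟨h, ⟨j, hj⟩, by rw [lqf_osing h, if_neg hX, zero_add]; exact hq⟩
  have hdisj : Disjoint ((Xs m).filter fun _ => ∃ j, j < n ∧ q = m - 1 + m * j)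
      ((Ys m).filter fun _ => 2 ≤ m ∧ ∃ j, j < n ∧ q = m * j) :=
    Finset.disjoint_filter_filter (WedgePair.disjoint_XY m)
  rw [hsplit, Finset.card_union_of_disjoint hdisj, Finset.filter_const, Finset.filter_const]
  congr 1
  · split_ifs
    · exact WedgePair.card_Xset m
    · rfl
  · split_ifs
    · exact WedgePair.card_Yset m
    · rfl

/-! ## §4. The reach conditions as residues mod `m` -/

/-- `∃ j < n, q = m − 1 + jm` iff `q < mn` and `q ≡ m − 1 (mod m)` (`m ≥ 1`). -/
lemma exists_X_reach_iff (hm : 1 ≤ m) (q : ℕ) : (∃ j, j < n ∧ q = m - 1 + m * j) ↔ q < m * n ∧ q % m = m - 1 := by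
  constructor
  · rintro ⟨j, hj, rfl⟩
    have h1 : m * j + m ≤ m * n := by
      calc m * j + m = m * (j + 1) := by ring
        _ ≤ m * n := Nat.mul_le_mul_left m hj
    refine ⟨by omega, ?_⟩
    rw [Nat.add_mul_mod_self_left, Nat.mod_eq_of_lt (by omega)]
  · rintro ⟨hq, hr⟩
    refine ⟨q / m, (Nat.div_lt_iff_lt_mul (by omega)).mpr (by rw [mul_comm]; exact hq), ?_⟩
    have h := Nat.div_add_mod q m
    rw [hr] at h
    omega

/-- `∃ j < n, q = jm` iff `q < mn` and `q ≡ 0 (mod m)` (`m ≥ 1`). -/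
lemma exists_Y_reach_iff (hm : 1 ≤ m) (q : ℕ) : (∃ j, j < n ∧ q = m * j) ↔ q < m * n ∧ q % m = 0 := by
  constructor
  · rintro ⟨j, hj, rfl⟩
    exact ⟨Nat.mul_lt_mul_of_pos_left hj (by omega), Nat.mul_mod_right m j⟩
  · rintro ⟨hq, hr⟩
    refine ⟨q / m, (Nat.div_lt_iff_lt_mul (by omega)).mpr (by rw [mul_comm]; exact hq), ?_⟩
    have h := Nat.div_add_mod q m
    rw [hr] at h
    omega

/-! ## §5. THE DEGREE-1 ROW in closed form, every `m ≥ 1`, `n` -/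

/-- the count in residue form: `|Fset m n 1 q| = mn` if `q < mn` and `q mod m ∈ {0, m − 1}`, else `0` (for `m = 1` the two residues
coincide and only the `X`-letter sources exist; for `m ≥ 2` they are distinct and each contributes `mn` on its own residue). -/
theorem card_Fset_one_closed (hm : 1 ≤ m) (q : ℕ) :
    (Fset m n 1 q).card = if q < m * n ∧ (q % m = 0 ∨ q % m = m - 1) then m * n else 0 := by
  rw [card_Fset_one, card_T1, if_congr (exists_X_reach_iff (n := n) hm q) rfl rfl]
  by_cases h2 : 2 ≤ m
  · have hY : (2 ≤ m ∧ ∃ j, j < n ∧ q = m * j) ↔ q < m * n ∧ q % m = 0 := by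
      rw [and_iff_right h2]
      exact exists_Y_reach_iff hm q
    rw [if_congr hY rfl rfl]
    have hne : m - 1 ≠ 0 := by omega
    by_cases hq : q < m * n
    · by_cases h0 : q % m = 0
      · rw [if_neg (fun h => hne (h.2.symm.trans h0)), if_pos ⟨hq, h0⟩, if_pos ⟨hq, Or.inl h0⟩]
        ring
      · by_cases h1 : q % m = m - 1
        · rw [if_pos ⟨hq, h1⟩, if_neg (fun h => h0 h.2), if_pos ⟨hq, Or.inr h1⟩]
          ring
        · rw [if_neg (fun h => h1 h.2), if_neg (fun h => h0 h.2), if_neg (fun h => h.2.elim h0 h1)]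
          ring
    · rw [if_neg (fun h => hq h.1), if_neg (fun h => hq h.1), if_neg (fun h => hq h.1)]
      ring
  · have hm1 : m = 1 := by omega
    subst hm1
    rw [if_neg (show ¬ (2 ≤ 1 ∧ ∃ j, j < n ∧ q = 1 * j) from fun h => absurd h.1 (by norm_num)), add_zero]
    have h0 : q % 1 = 0 := Nat.mod_one q
    by_cases hq : q < 1 * n
    · rw [if_pos ⟨hq, h0⟩, if_pos ⟨hq, Or.inl h0⟩]
      ring
    · rw [if_neg (fun h => hq h.1), if_neg (fun h => hq h.1)]
      ring

/-- **THE DEGREE-1 PER-`q` ROW, UNIFORM IN `n` AND `m`.**  For every field `K`, every `m ≥ 1`, every `n`, every block `q` and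
`a, c ≠ 0`: the `q`-block of `θ ↦ θ ∧ F` on `⋀¹ K^{(m+m)n}` has rank `mn` if `q < mn` and `q mod m ∈ {0, m − 1}`, and `0` otherwise —
the one-letter sources are the `mn` `X`-letters (`q`-part `m − 1`, reaching `q ≡ −1`) and, for `m ≥ 2`, the `mn` `Y`-letters
(`q`-part `0`, reaching `q ≡ 0`), each class running over the `n` shifts `jm` of its `n − 1` empty blocks; `m = 2`: every `q < 2n`
(the surface row `2n`); `m = 3`, `n = 3`: `(9,0,9,9,0,9,9,0,9,0)`. -/
theorem finrank_range_blockProj_wedge_pairBox_one_closed (hm : 1 ≤ m) {a c : K} (ha : a ≠ 0) (hc : c ≠ 0) (q : ℕ) :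
    finrank K (LinearMap.range (blockProj K m n q ∘ₗ wedge K (Fin ((m + m) * n)) 1 (pairBox K (m := m) (n := n) a c))) =
      if q < m * n ∧ (q % m = 0 ∨ q % m = m - 1) then m * n else 0 := by
  rw [finrank_range_blockProj_wedge_pairBox_eq_card K hm ha hc, card_Fset_one_closed hm]

/-- the same as arithmetic of p10's enumerator: **`genCount m n 1 q = mn·[q < mn ∧ q mod m ∈ {0, m − 1}]`** (`m ≥ 1`). -/
theorem genCount_one_closed (hm : 1 ≤ m) (n q : ℕ) :
    FormulaN.Uniform.genCount m n 1 q = if q < m * n ∧ (q % m = 0 ∨ q % m = m - 1) then m * n else 0 := by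
  rw [← card_Fset (n := n) hm, card_Fset_one_closed hm]

/-- the rows of record: `m = 3`, `n = 3` gives `(9,0,9,9,0,9,9,0,9,0)`; `m = 2` (surfaces), `n = 3` gives `(6,6,6,6,6,6,0)`. -/
theorem genCount_one_rows :
    (List.range 10).map (fun q => FormulaN.Uniform.genCount 3 3 1 q) = [9, 0, 9, 9, 0, 9, 9, 0, 9, 0] ∧
      (List.range 7).map (fun q => FormulaN.Uniform.genCount 2 3 1 q) = [6, 6, 6, 6, 6, 6, 0] := by
  simp only [genCount_one_closed (show 1 ≤ 3 by norm_num), genCount_one_closed (show 1 ≤ 2 by norm_num)]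
  decide

end Summit.Ventures.HSemireg.Wedge.PairPowers
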